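import Summits.PneNP.PneNP.Theorems.OracleRefusal.Negative.StaInvChainDesc

/-!
# `OracleRefusal` (stmt-PneNP-1864) — negative side, II: Semantic inversion, part 7 (§B.8, second half): the `(⊸E)` step of a chain (`chain_app_step`, `chain_app_step0`) and the
RUNS OF A CHAIN (`chain_runs`): every run of every derivation is described by chain data.
-/

namespace Summit.PneNP.PneNP.Theorems.OracleRefusal.Negative

open Literature.Computability.ImplicitComplexity
open Literature.Computability.ImplicitComplexity.URel
open Literature.Computability.ImplicitComplexity.STA (Deriv Ctx Term LinTy SoftTy encWord encBit tyS tyB tyF mpxRen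
  liftRen)

/-- A slot absent from the function-side context carries no label in a function-side run. [folklore] -/
theorem none_of_isSome {ρ : Val} {Γ : Ctx} (h : ∀ s, (ρ s).isSome = (Γ s).isSome) {s : ℕ} (hs : Γ s = none) :
    ρ s = none := by
  have := h s
  rw [hs] at this
  cases hρ : ρ s with
  | none => rfl
  | some v => rw [hρ] at this; simp at this

/-- The runs of a `≤ 1`-box, for a bang count known to be `0` only propositionally (keeps the argument derivation's
type index untouched). [cite: LaurentTortoraDeFalco2006, Def. 12] -/
theorem liftArg_cases {k : ℕ} (hk : k = 0) {Γ : STA.Ctx} {S : Set (Val × Point)} {r : Val × Point}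
    (h : r ∈ liftArg k Γ S) : (∃ ρ b, (ρ, b) ∈ S ∧ r = (ρ, bang1 b)) ∨ r = (Val.discard Γ, bang0) := by
  subst hk; exact h

/-- One copy of a run is a run of the `≤ 1`-box (bang count `0` propositionally). [cite: LaurentTortoraDeFalco2006, Def. 12] -/
theorem mem_liftArg_one {k : ℕ} (hk : k = 0) {Γ : STA.Ctx} {S : Set (Val × Point)} {ρ : Val} {b : Point}
    (h : (ρ, b) ∈ S) : (ρ, bang1 b) ∈ liftArg k Γ S := by
  subst hk; exact Or.inl ⟨ρ, b, h, rfl⟩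

/-- **The `(⊸E)` step of a chain, rest evaluated**: juxtaposing a head run (slot `c` wrapped around the new
occurrence point) with a described run of the shorter chain gives a described run of the longer chain.
[cite: LaurentTortoraDeFalco2006, Def. 12] -/
theorem chain_app_step {Γ Γ₁ Γ₂ : Ctx} {ρ₁ ρ₂ : Val} {c z : ℕ} {hs' : List ℕ} {J' n' : ℕ} {qs' P' R' : ℕ → Point}
    {Pb q : Point} (hs : Γ.Split Γ₁ Γ₂) (hΓ₁c : Γ₁ c = Γ c) (hΓ₂z : Γ₂ z = Γ z) (hΓ₁z : Γ₁ z = none)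
    (hΓ₂h : ∀ s ∈ hs', Γ₂ s = Γ s ∧ Γ₁ s = none)
    (hV₁ : VarSpec Γ₁ c ρ₁ (occPt Pb (bang1 (qs' 0)) q)) (hsome₁ : ∀ s, (ρ₁ s).isSome = (Γ₁ s).isSome)
    (hH' : HeadsDesc Γ₂ ρ₂ hs' {z} J' qs' P' R') (hT' : ChainTail Γ₂ ρ₂ z n' J' qs' R') (hzc : z ≠ c) :
    HeadsDesc Γ (Val.merge ρ₁ ρ₂) (c :: hs') {z} (J' + 1) (consF q qs') (consF Pb P') (consF (bang1 (qs' 0)) R') ∧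
      ChainTail Γ (Val.merge ρ₁ ρ₂) z (n' + 1) (J' + 1) (consF q qs') (consF (bang1 (qs' 0)) R') := by
  obtain ⟨⟨σc, hσc⟩, hWc, hJ₁⟩ := hV₁
  obtain ⟨hHd, hN, hCov⟩ := hH'
  have hρ₁ : ∀ s, Γ₁ s = none → ρ₁ s = none := fun s h => none_of_isSome hsome₁ h
  have hL : Lset (J' + 1) (consF q qs') (consF Pb P') (consF (bang1 (qs' 0)) R') =
      insert (occPt Pb (bang1 (qs' 0)) q) (Lset J' qs' P' R') := Lset_cons ..
  refine ⟨⟨fun s hs' => ?_, fun s hs₁ hs₂ => ?_, fun j hj => ?_⟩, ?_⟩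
  · rw [hL]
    rcases List.mem_cons.1 hs' with rfl | hs'
    · exact (hWc.mono fun k => wrap_subset_argClique (Set.mem_insert _ _) k).merge_left hΓ₁c
    · exact (HeadsDesc.slot_mono (Set.subset_insert _ _) (hHd s hs')).merge_right (hρ₁ s (hΓ₂h s hs').2)
        (hΓ₂h s hs').1
  · have hsc : s ≠ c := fun e => hs₁ (e ▸ List.mem_cons_self ..)
    have hsh : s ∉ hs' := fun h => hs₁ (List.mem_cons_of_mem _ h)
    rcases hs s with ⟨h1, -⟩ | ⟨h1, h2⟩
    · exact (hJ₁ s hsc).merge_left h1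
    · exact (hN s hsh hs₂).merge_right (hρ₁ s h1) h2
  · rcases j with _ | j
    · obtain ⟨Vc, hVc, hVm⟩ := hWc σc hσc
      exact ⟨c, List.mem_cons_self .., σc, Vc, hΓ₁c ▸ hσc, by simp [Val.merge, hVc], mem_leafSet_of_wrap hVm⟩
    · obtain ⟨s, hs', σ, V, hΓs, hρs, hm⟩ := hCov j (by omega)
      refine ⟨s, List.mem_cons_of_mem _ hs', σ, V, (hΓ₂h s hs').1 ▸ hΓs, ?_, hm⟩
      simp [Val.merge, hρ₁ s (hΓ₂h s hs').2, hρs]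
  · rcases hT' with ⟨hJn, hRn, hWz⟩ | ⟨hJ1, hR0, hJz⟩
    · refine Or.inl ⟨by omega, fun j hj => ?_, (hWz.merge_right (hρ₁ z hΓ₁z) hΓ₂z : _)⟩
      obtain rfl : j = n' := by omega
      rcases j with _ | m
      · rfl
      · exact hRn m rfl
    · refine Or.inr ⟨by omega, ?_, hJz.merge_right (hρ₁ z hΓ₁z) hΓ₂z⟩
      obtain ⟨J'', rfl⟩ : ∃ J'', J' = J'' + 1 := ⟨J' - 1, by omega⟩
      simpa using hR0

/-- **The `(⊸E)` step of a chain, rest discarded**: the run takes no copy of the rest, whose valuation is the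
discarding one; one evaluated position. [cite: LaurentTortoraDeFalco2006, Def. 12] -/
theorem chain_app_step0 {Γ Γ₁ Γ₂ : Ctx} {ρ₁ : Val} {c z : ℕ} {hs' : List ℕ} {n' : ℕ} {Pb q : Point}
    (hs : Γ.Split Γ₁ Γ₂) (hΓ₁c : Γ₁ c = Γ c) (hΓ₂z : Γ₂ z = Γ z) (hΓ₁z : Γ₁ z = none)
    (hΓ₂h : ∀ s ∈ hs', Γ₂ s = Γ s ∧ Γ₁ s = none)
    (hV₁ : VarSpec Γ₁ c ρ₁ (occPt Pb bang0 q)) (hsome₁ : ∀ s, (ρ₁ s).isSome = (Γ₁ s).isSome) (hzc : z ≠ c)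
    (f g : ℕ → Point) :
    HeadsDesc Γ (Val.merge ρ₁ (Val.discard Γ₂)) (c :: hs') {z} 1 (consF q f) (consF Pb g) (consF bang0 g) ∧
      ChainTail Γ (Val.merge ρ₁ (Val.discard Γ₂)) z (n' + 1) 1 (consF q f) (consF bang0 g) := by
  obtain ⟨⟨σc, hσc⟩, hWc, hJ₁⟩ := hV₁
  have hρ₁ : ∀ s, Γ₁ s = none → ρ₁ s = none := fun s h => none_of_isSome hsome₁ h
  have hL : Lset 1 (consF q f) (consF Pb g) (consF bang0 g) = insert (occPt Pb bang0 q) (Lset 0 f g g) := Lset_cons ..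
  refine ⟨⟨fun s hs' => ?_, fun s hs₁ hs₂ => ?_, fun j hj => ?_⟩, ?_⟩
  · rw [hL]
    rcases List.mem_cons.1 hs' with rfl | hs'
    · exact (hWc.mono fun k => wrap_subset_argClique (Set.mem_insert _ _) k).merge_left hΓ₁c
    · exact ((SlotIn.discard Γ₂ s).mono fun k => junk_subset_argClique _ k).merge_right (hρ₁ s (hΓ₂h s hs').2)
        (hΓ₂h s hs').1
  · have hsc : s ≠ c := fun e => hs₁ (e ▸ List.mem_cons_self ..)
    rcases hs s with ⟨h1, -⟩ | ⟨h1, h2⟩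
    · exact (hJ₁ s hsc).merge_left h1
    · exact (SlotIn.discard Γ₂ s).merge_right (hρ₁ s h1) h2
  · obtain rfl : j = 0 := by omega
    obtain ⟨Vc, hVc, hVm⟩ := hWc σc hσc
    exact ⟨c, List.mem_cons_self .., σc, Vc, hΓ₁c ▸ hσc, by simp [Val.merge, hVc], mem_leafSet_of_wrap hVm⟩
  · exact Or.inr ⟨le_rfl, rfl, (SlotIn.discard Γ₂ z).merge_right (hρ₁ z hΓ₁z) hΓ₂z⟩

/-- **Runs of a chain.** Every run of every derivation of a chain (tail `z` not a head, heads with kernels that are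
anti-instances of the step type) is described by chain data: heads carry box trees over the occurrence points, other
slots junk, every occurrence point a real leaf of a head slot, and the tail slot wrapped around the last chain value
or junk after a discarded rest. [cite: LaurentTortoraDeFalco2006, Def. 12] -/
theorem chain_runs : {d : ℕ} → {Γ : Ctx} → {M : Term} → {σ : SoftTy} → (D : Deriv d Γ M σ) → {z : ℕ} →
    {bs : List Bool} → {hs : List ℕ} → IsChain z M bs hs → σ.bangs = 0 → z ∉ hs →
    (∀ c ∈ hs, ∃ k K, Γ c = some ⟨k, K⟩ ∧ KernelOK K) →
      ∀ {ρ : Val} {q : Point}, (ρ, q) ∈ D.interp → ∃ J qs P R, qs 0 = q ∧ ChainData bs J qs P R ∧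
        HeadsDesc Γ ρ hs {z} J qs P R ∧ ChainTail Γ ρ z bs.length J qs R
  | _, _, _, _, .ax h, z, bs, hs, hC, _, _, _, ρ, q, hr => by
      obtain ⟨rfl, rfl, rfl⟩ := hC.var_inv
      have hV := var_runs (.ax h) rfl rfl hr
      refine ⟨0, fun _ => q, fun _ => bang0, fun _ => bang0, rfl, ⟨le_rfl, fun h => (h rfl).elim, fun j hj => by omega,
        fun j hj => by omega⟩, ⟨fun s hs => by simp at hs, fun s _ hsz => hV.2.2 s hsz, fun j hj => by omega⟩, ?_⟩
      exact Or.inl ⟨rfl, fun j hj => by simp at hj, hV.2.1⟩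
  | _, _, _, _, .weak (Γ := Γ) j A h hj hΓ', z, bs, hs, hC, hσ, hzh, hK, ρ, q, hr => by
      obtain ⟨⟨τ, hτ⟩, hhp⟩ := chain_present h hC
      have hzj : z ≠ j := fun e => by rw [e, hj] at hτ; cases hτ
      have hK' : ∀ c ∈ hs, ∃ k K, Γ c = some ⟨k, K⟩ ∧ KernelOK K := fun c hc => by
        obtain ⟨k, K, hΓc, hKc⟩ := hK c hc
        obtain ⟨τ', hτ'⟩ := hhp c hc
        have hcj : c ≠ j := fun e => by rw [e, hj] at hτ'; cases hτ'
        rw [hΓ', Function.update_of_ne hcj] at hΓc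
        exact ⟨k, K, hΓc, hKc⟩
      obtain ⟨ρ', p, hm, he⟩ := hr
      obtain ⟨J, qs, P, R, hq, hD, hH, hT⟩ := chain_runs h hC hσ hzh hK' hm
      simp only [Prod.mk.injEq] at he
      obtain ⟨rfl, rfl⟩ := he
      subst hΓ'
      exact ⟨J, qs, P, R, hq, hD, hH.weak hj A, hT.weak hzj _ _⟩
  | _, _, _, _, .lam _, _, _, _, hC, _, _, _, _, _, _ => hC.lam_inv.elim
  | _, _, _, _, .app (Γ := Γ) (Γ₁ := Γ₁) (Γ₂ := Γ₂) (k := k) (B := B) (A := A) hs h₁ h₂, z, bs, hds, hC, _, hzh, hK,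
      ρ, q, hr => by
      obtain ⟨c, b, bs', hs', hM₁, rfl, rfl, hC'⟩ := hC.app_inv
      -- presence and the split
      obtain ⟨⟨τz, hτz⟩, hhp'⟩ := chain_present h₂ hC'
      obtain ⟨τc, hτc⟩ := app1_present h₁ hM₁
      have hΓ₁c : Γ₁ c = Γ c := by
        rcases hs c with ⟨h1, -⟩ | ⟨h1, -⟩
        · exact h1
        · rw [h1] at hτc; cases hτc
      have hΓ₂z : Γ₂ z = Γ z := by
        rcases hs z with ⟨-, h2⟩ | ⟨-, h2⟩
        · rw [h2] at hτz; cases hτz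
        · exact h2
      have hΓ₁z : Γ₁ z = none := by
        rcases hs z with ⟨-, h2⟩ | ⟨h1, -⟩
        · rw [h2] at hτz; cases hτz
        · exact h1
      have hΓ₂h : ∀ s ∈ hs', Γ₂ s = Γ s ∧ Γ₁ s = none := fun s hs' => by
        obtain ⟨τ', hτ'⟩ := hhp' s hs'
        rcases hs s with ⟨-, h2⟩ | ⟨h1, h2⟩
        · rw [h2] at hτ'; cases hτ'
        · exact ⟨h2, h1⟩
      have hzc : z ≠ c := fun e => hzh (e ▸ List.mem_cons_self ..)
      have hzh' : z ∉ hs' := fun h => hzh (List.mem_cons_of_mem _ h)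
      -- the kernel of `c`: an arrow with one linear BoolLike argument; the outer application is linear (`k = 0`)
      obtain ⟨k₀, K, hΓc, hKc⟩ := hK c (List.mem_cons_self ..)
      rw [← hΓ₁c] at hΓc
      rcases hKc.cases with ⟨n, rfl⟩ | ⟨B₁, A₁, rfl, hB₁, hA₁⟩
      · obtain ⟨_, _, _, h, -⟩ := app1_ty h₁ hM₁ rfl hΓc rfl
        cases h
      · have hpA : peel A₁ = A₁ := by rcases hA₁ with ⟨n, rfl⟩ | ⟨A₂, A₃, rfl⟩ <;> rfl
        obtain ⟨k₁, B₁', A₁', hK₁, hj⟩ := app1_ty h₁ hM₁ rfl hΓc rfl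
        simp only [LinTy.limp.injEq] at hK₁
        obtain ⟨rfl, rfl, rfl⟩ := hK₁
        obtain ⟨j, hj⟩ := hj hpA
        have hk : k = 0 := by
          rcases j with _ | j
          · change LinTy.limp k B A = A₁.rename (· + 0) at hj
            rcases hA₁ with ⟨n, rfl⟩ | ⟨A₂, A₃, rfl⟩
            · cases hj
            · simp only [STA.LinTy.rename, LinTy.limp.injEq] at hj
              exact hj.1
          · change LinTy.limp k B A = LinTy.all _ at hj
            cases hj
        have hK' : ∀ c' ∈ hs', ∃ k K, Γ₂ c' = some ⟨k, K⟩ ∧ KernelOK K := fun c' hc' => by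
          obtain ⟨k', K', hΓc', hKc'⟩ := hK c' (List.mem_cons_of_mem _ hc')
          exact ⟨k', K', by rw [(hΓ₂h c' hc').1]; exact hΓc', hKc'⟩
        -- the run
        obtain ⟨ρ₁, ρ₂, V, q', hm₁, hm₂, he⟩ := hr
        simp only [Prod.mk.injEq] at he
        obtain ⟨rfl, rfl⟩ := he
        obtain ⟨Pb, hPb, hV₁⟩ := app1_runs h₁ hM₁ rfl hΓc hB₁ hm₁
        have hsome₁ : ∀ s, (ρ₁ s).isSome = (Γ₁ s).isSome := h₁.isSome_of_mem_interp hm₁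
        rcases liftArg_cases hk hm₂ with ⟨ρ₂', r, hr₂, he₂⟩ | he₂
        · -- rest evaluated: one copy `![r]`
          simp only [Prod.mk.injEq] at he₂
          obtain ⟨rfl, rfl⟩ := he₂
          obtain ⟨J', qs', P', R', hq', hD', hH', hT'⟩ := chain_runs h₂ hC' hk hzh' hK' hr₂
          subst hq'
          exact ⟨J' + 1, consF q qs', consF Pb P', consF (bang1 (qs' 0)) R', rfl, hD'.cons hPb,
            chain_app_step hs hΓ₁c hΓ₂z hΓ₁z hΓ₂h hV₁ hsome₁ hH' hT' hzc⟩
        · -- rest discarded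
          simp only [Prod.mk.injEq] at he₂
          obtain ⟨rfl, rfl⟩ := he₂
          exact ⟨1, consF q (fun _ => q), consF Pb (fun _ => bang0), consF bang0 (fun _ => bang0), rfl,
            ChainData.one hPb, chain_app_step0 hs hΓ₁c hΓ₂z hΓ₁z hΓ₂h hV₁ hsome₁ hzc _ _⟩
  | _, _, _, _, .mpx (Γ := Γ) (σ := τ₀) S j h hS hj hΓ' hM', z, bs, hs, hC, hσ, hzh, hK, ρ, q, hr => by
      rw [hM'] at hC
      obtain ⟨z₀, hs₀, hC₀, hz₀, hhs⟩ := hC.of_rename rfl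
      obtain ⟨⟨τ, hτ⟩, hhp⟩ := chain_present h hC₀
      have hjS : j ∉ S := fun hj' => by simpa [hj] using hS j hj'
      subst hz₀; subst hhs
      have hzh₀ : z₀ ∉ hs₀ := fun hm => hzh (List.mem_map.2 ⟨z₀, hm, rfl⟩)
      have hK₀ : ∀ c ∈ hs₀, ∃ k K, Γ c = some ⟨k, K⟩ ∧ KernelOK K := by
        intro c₀ hc₀
        obtain ⟨k, K, hΓc, hKc⟩ := hK _ (List.mem_map.2 ⟨c₀, hc₀, rfl⟩)
        obtain ⟨τ', hτ'⟩ := hhp c₀ hc₀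
        have hcj : c₀ ≠ j := fun e => by rw [e, hj] at hτ'; cases hτ'
        rw [hΓ'] at hΓc
        by_cases hcS : c₀ ∈ S
        · simp only [mpxRen, hcS, if_true, Ctx.mpx, hjS, if_false, Option.some.injEq] at hΓc
          refine ⟨τ₀.bangs, K, ?_, hKc⟩
          rw [hS c₀ hcS, ← show τ₀.lin = K from congrArg SoftTy.lin hΓc]
        · simp only [mpxRen, hcS, if_false, Ctx.mpx, hcj] at hΓc
          exact ⟨k, K, hΓc, hKc⟩
      obtain ⟨ρ', p, hm, he⟩ := hr
      obtain ⟨J, qs, P, R, hq, hD, hH, hT⟩ := chain_runs h hC₀ hσ hzh₀ hK₀ hm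
      simp only [Prod.mk.injEq] at he
      obtain ⟨rfl, rfl⟩ := he
      subst hΓ'
      obtain ⟨hH', hT'⟩ := chainInv_mpx hH hT hS hj hzh ⟨τ, hτ⟩ hhp
      exact ⟨J, qs, P, R, hq, hD, hH', hT'⟩
  | _, _, _, _, .sp _ _, _, _, _, _, hσ, _, _, _, _, _ => by simp at hσ
  | _, _, _, _, .allI (Γ := Γ) h hΔ, z, bs, hs, hC, _, hzh, hK, ρ, q, hr => by
      have hK' : ∀ c ∈ hs, ∃ k K, Γ.shift c = some ⟨k, K⟩ ∧ KernelOK K := fun c hc => by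
        obtain ⟨k, K, hΓc, hKc⟩ := hK c hc
        exact ⟨k, K.rename Nat.succ, by simp [Ctx.shift, hΓc]; rfl, hKc.rename_succ⟩
      rw [← hΔ] at hK'
      obtain ⟨J, qs, P, R, hq, hD, hH, hT⟩ := chain_runs h hC rfl hzh hK' hr
      rw [hΔ] at hH hT
      exact ⟨J, qs, P, R, hq, hD, hH.of_shift, hT.of_shift⟩
  | _, _, _, _, .allE _ h, _, _, _, hC, _, hzh, hK, _, _, hr => chain_runs h hC rfl hzh hK hr
  | _, _, _, _, .sum _ _, _, _, _, hC, _, _, _, _, _, _ => hC.sum_inv.elim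

end Summit.PneNP.PneNP.Theorems.OracleRefusal.Negative
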